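import Summits.QuantumFields.YangMills.Theorems.WeakCouplingRatesBulkDominatesColdBoxWDatumBackground

/-!
# LINE-18 v5 (crux `AllWindowsColdBox.BulkMidWindowSU2`, ⟨stmt-QuantumFields-24006⟩), toward stub K3′ `stub_harmonicMaxPrincipleFlux`:
# the harmonic extension's circulation through ANY admissible competitor, `F̄ = c − K·c`

For the temporal-gauge Dirichlet problem of the cold box (pinned predicate `· ∉ dirFreeEdges H`, enlarged vertex box `dirCorner + {0,…,2H+2}⁴`)
write `F̄_p = sCirc (glue ϑ (mean ϑ)) p` for the circulation of the Maxwell-energy minimiser (the harmonic extension of the datum `ϑ`) and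
`K = boxDirProjKernel H` for the Dirichlet box projection kernel `K_{pq} = λ_p · Q⁻¹ λ_q`.  Since `K` is the kernel of the orthogonal projection onto
the curls of free edge functions, `F̄` is the component of the datum's circulation vector orthogonal to those curls, and hence can be computed from
the circulation vector `c_q = sCirc (glue ϑ s) q` of ANY admissible competitor (any free values `s`):

* `sum_kernel_mul_sCirc_glue` — `Σ_q K_{p,a+q} · sCirc (glue ϑ s) (a+q) = λ_p · s − λ_p · mean ϑ` (sum over the plaquettes of the enlarged box);
* `dirBackground_eq_sCirc_sub_sum_kernel` — **`F̄_p = c_p − Σ_q K_{p,a+q} c_{a+q}`** for every `s` and every plaquette key `p`.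

Pure finite-dimensional linear algebra over the tree's `LatticeMaxwell` apparatus (`sCirc_glue`, `Qmat`, `vvec`, `mean`, ✓`posDef_dirQmat`,
✓`Qmat_mulVec_mean`); no definition, standard axioms.  HONEST LABEL: helper toward ONE registered stub of a critic-passed line on the R2ξ″
RECORD-rung crux 24006; no stub, crux, rung or summit is proved here; the Yang–Mills mass gap is NOT proved by this file.
-/

set_option autoImplicit false

noncomputable section

open Finset Matrix
open Literature.Probability.LatticeModels
open Literature.MathematicalPhysics.QuantumFieldTheory
open Literature.MathematicalPhysics.QuantumFieldTheory.LatticeMaxwell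
open Literature.MathematicalPhysics.QuantumFieldTheory.AxialGauge
open Summit.QuantumFields.YangMills.Theorems.WeakCouplingRates

namespace Summit.QuantumFields.YangMills.Theorems.AllWindowsColdBoxBulkMidLine

/-! ## Linear algebra of the precision matrix -/

section General

variable {d : ℕ} {pin : Literature.MathematicalPhysics.QuantumLattice.ZdEdge d → Prop} [DecidablePred pin]
  {a : Site d} {n : ℕ}

/-- `Q s = Σ_q (λ_{a+q} · s) λ_{a+q}`. -/
theorem Qmat_mulVec_eq_sum (s : LatticeMaxwell.Free pin a n → ℝ) :
    Qmat pin a n *ᵥ s = ∑ q ∈ plaquettesIn (halfOpenBox d n), (coeff pin a n (Plaq.shift a q) ⬝ᵥ s) • coeff pin a n (Plaq.shift a q) := by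
  rw [Qmat, Matrix.sum_mulVec]
  refine Finset.sum_congr rfl fun q _ => ?_
  ext i
  simp only [Matrix.mulVec, vecMulVec_apply, dotProduct, Pi.smul_apply, smul_eq_mul, Finset.sum_mul]
  exact Finset.sum_congr rfl fun j _ => by ring

/-- Linearity: `Σ_q (u · M λ_{a+q}) r_q = u · M (Σ_q r_q λ_{a+q})`. -/
theorem sum_dotProduct_mulVec_coeff_mul (u : LatticeMaxwell.Free pin a n → ℝ)
    (M : Matrix (LatticeMaxwell.Free pin a n) (LatticeMaxwell.Free pin a n) ℝ) (r : Plaq d → ℝ) :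
    ∑ q ∈ plaquettesIn (halfOpenBox d n), (u ⬝ᵥ (M *ᵥ coeff pin a n (Plaq.shift a q))) * r (Plaq.shift a q) =
      u ⬝ᵥ (M *ᵥ ∑ q ∈ plaquettesIn (halfOpenBox d n), r (Plaq.shift a q) • coeff pin a n (Plaq.shift a q)) := by
  rw [Matrix.mulVec_sum, dotProduct_sum]
  refine Finset.sum_congr rfl fun q _ => ?_
  rw [Matrix.mulVec_smul, dotProduct_smul, smul_eq_mul, mul_comm]

/-- For a positive definite precision matrix: `Σ_q (λ_p · Q⁻¹ λ_{a+q}) · sCirc (glue θ s) (a+q) = λ_p · s − λ_p · mean θ`. -/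
theorem sum_kernel_mul_sCirc_glue_of_posDef (hQ : (Qmat pin a n).PosDef)
    (θ : Literature.MathematicalPhysics.QuantumLattice.ZdEdge d → ℝ) (s : LatticeMaxwell.Free pin a n → ℝ) (p : Plaq d) :
    ∑ q ∈ plaquettesIn (halfOpenBox d n),
        (coeff pin a n p ⬝ᵥ ((Qmat pin a n)⁻¹ *ᵥ coeff pin a n (Plaq.shift a q))) *
          sCirc (LatticeMaxwell.glue (pin := pin) a n θ s) (Plaq.shift a q) =
      coeff pin a n p ⬝ᵥ s - coeff pin a n p ⬝ᵥ mean pin a n θ := by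
  have hu := (Matrix.isUnit_iff_isUnit_det _).1 hQ.isUnit
  have hc : ∀ q : Plaq d, sCirc (LatticeMaxwell.glue (pin := pin) a n θ s) q = coeff pin a n q ⬝ᵥ s + bterm pin a n θ q :=
    fun q => sCirc_glue θ s q
  simp_rw [hc]
  rw [sum_dotProduct_mulVec_coeff_mul (pin := pin) (a := a) (n := n) (coeff pin a n p) ((Qmat pin a n)⁻¹)
    (fun q => coeff pin a n q ⬝ᵥ s + bterm pin a n θ q)]
  have hsplit : ∑ q ∈ plaquettesIn (halfOpenBox d n),
      (coeff pin a n (Plaq.shift a q) ⬝ᵥ s + bterm pin a n θ (Plaq.shift a q)) • coeff pin a n (Plaq.shift a q) =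
      Qmat pin a n *ᵥ s + vvec pin a n θ := by
    rw [Qmat_mulVec_eq_sum, vvec, ← Finset.sum_add_distrib]
    exact Finset.sum_congr rfl fun q _ => by rw [add_smul]
  rw [hsplit, Matrix.mulVec_add, Matrix.mulVec_mulVec, Matrix.nonsing_inv_mul _ hu, Matrix.one_mulVec]
  have hmean : (Qmat pin a n)⁻¹ *ᵥ vvec pin a n θ = -mean pin a n θ := by
    rw [mean, neg_neg]
  rw [hmean, dotProduct_add, dotProduct_neg]
  ring

/-- **The harmonic extension through an arbitrary admissible competitor** (general pinned box with positive definite precision matrix):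
`sCirc (glue θ (mean θ)) p = sCirc (glue θ s) p − Σ_q (λ_p · Q⁻¹ λ_{a+q}) · sCirc (glue θ s) (a+q)` for every free `s` and every key `p`. -/
theorem sCirc_glue_mean_eq_of_posDef (hQ : (Qmat pin a n).PosDef)
    (θ : Literature.MathematicalPhysics.QuantumLattice.ZdEdge d → ℝ) (s : LatticeMaxwell.Free pin a n → ℝ) (p : Plaq d) :
    sCirc (LatticeMaxwell.glue (pin := pin) a n θ (mean pin a n θ)) p =
      sCirc (LatticeMaxwell.glue (pin := pin) a n θ s) p -
        ∑ q ∈ plaquettesIn (halfOpenBox d n),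
          (coeff pin a n p ⬝ᵥ ((Qmat pin a n)⁻¹ *ᵥ coeff pin a n (Plaq.shift a q))) *
            sCirc (LatticeMaxwell.glue (pin := pin) a n θ s) (Plaq.shift a q) := by
  rw [sum_kernel_mul_sCirc_glue_of_posDef hQ, sCirc_glue θ (mean pin a n θ) p, sCirc_glue θ s p]
  ring

end General

/-! ## The Dirichlet box of the cold wall -/

variable (H : ℕ) (ϑ : Literature.MathematicalPhysics.QuantumLattice.ZdEdge 4 → ℝ)

/-- **`F̄ = c − K·c`** for the temporal-gauge Dirichlet problem of the cold box: for every free `s : DirFree H → ℝ` and every plaquette key `p`,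
`sCirc (glue ϑ (mean ϑ)) p = sCirc (glue ϑ s) p − Σ_{q} boxDirProjKernel H p (dirCorner + q) · sCirc (glue ϑ s) (dirCorner + q)`, the sum running over
the plaquettes `q` of `{0,…,2H+2}⁴`. -/
theorem dirBackground_eq_sCirc_sub_sum_kernel (s : DirFree H → ℝ) (p : Plaq 4) :
    sCirc (LatticeMaxwell.glue (pin := fun e => e ∉ dirFreeEdges H) dirCorner (2 * H + 3) ϑ
        (mean (fun e => e ∉ dirFreeEdges H) dirCorner (2 * H + 3) ϑ)) p =
      sCirc (LatticeMaxwell.glue (pin := fun e => e ∉ dirFreeEdges H) dirCorner (2 * H + 3) ϑ s) p -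
        ∑ q ∈ plaquettesIn (halfOpenBox 4 (2 * H + 3)),
          boxDirProjKernel H p (Plaq.shift dirCorner q) *
            sCirc (LatticeMaxwell.glue (pin := fun e => e ∉ dirFreeEdges H) dirCorner (2 * H + 3) ϑ s) (Plaq.shift dirCorner q) := by
  have h := sCirc_glue_mean_eq_of_posDef (posDef_dirQmat H) ϑ s p
  simpa only [boxDirProjKernel] using h

/-- The absolute-value form: `|F̄_p| ≤ |c_p| + Σ_q |K_{p,a+q}| · |c_{a+q}|`. -/
theorem abs_dirBackground_le_abs_add_sum (s : DirFree H → ℝ) (p : Plaq 4) :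
    |sCirc (LatticeMaxwell.glue (pin := fun e => e ∉ dirFreeEdges H) dirCorner (2 * H + 3) ϑ
        (mean (fun e => e ∉ dirFreeEdges H) dirCorner (2 * H + 3) ϑ)) p| ≤
      |sCirc (LatticeMaxwell.glue (pin := fun e => e ∉ dirFreeEdges H) dirCorner (2 * H + 3) ϑ s) p| +
        ∑ q ∈ plaquettesIn (halfOpenBox 4 (2 * H + 3)),
          |boxDirProjKernel H p (Plaq.shift dirCorner q)| *
            |sCirc (LatticeMaxwell.glue (pin := fun e => e ∉ dirFreeEdges H) dirCorner (2 * H + 3) ϑ s) (Plaq.shift dirCorner q)| := by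
  rw [dirBackground_eq_sCirc_sub_sum_kernel H ϑ s p]
  refine (abs_sub _ _).trans (add_le_add le_rfl ?_)
  refine (Finset.abs_sum_le_sum_abs _ _).trans (le_of_eq ?_)
  exact Finset.sum_congr rfl fun q _ => abs_mul _ _

end Summit.QuantumFields.YangMills.Theorems.AllWindowsColdBoxBulkMidLine

end
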